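import Summits.SmoothPoincare4.SmoothPoincare4.Theorems.CongruenceShadowsAgkCor6SufficiencyFlowerCapDefs

/-!
# Crux `AgkCor6Sufficiency` (item stmt-SmoothPoincare4-10894), line `lp-by-sphere-system-surgery`:
# stub `stub_capSeams` — the seams of the capped melon (lead c2, r6b)

The incidences of the capped melon on the flower surface: consecutive capped slices
`capS g (k-1)`, `capS g k` (indeed the union of the first `k` capped slices and the `k`-th) meet
inside the truncated arc `tArc hg k`, and the last capped slice meets the union of the others inside
the two truncated arcs through the lower pole.  These are the melon incidences of `FlowerMelon`
(`fanW_inter_secW_subset`, `fanW_inter_secW_last_subset`) with the cap removed, plus the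
identification of the part of a melon arc outside the cap with the truncated arc
(`range_arcK_diff_capU_subset_range_tArc`).

References: Hatcher, Algebraic Topology (2002), §1.2; Gay–Kirby, Geom. Topol. 20 (2016), Def. 1.
-/

set_option linter.dupNamespace false

noncomputable section

open Set Function Metric
open scoped Real unitInterval

namespace Summit.SmoothPoincare4.SmoothPoincare4.Cruxes.AgkCor6Sufficiency.LpBySphereSystemSurgery

open Literature.Topology.FourManifolds Literature.Topology.FourManifolds.FlowerModel
open PlanarThickening PlanarDouble

namespace FlowerCap

variable {g : ℕ}

/-- **A point of a melon arc outside the cap lies on the truncated arc.**  A point of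
`arcK hg k` is `Rk g k (vArcFun hg s')` with `0 ≤ s' ≤ 2ρ₄`; if `s' < 1/4 ≤ ρ₄` it is the rotated
upper-sheet point over `pol s' (π/g)`, of planar radius `s' < 1/4` and height `vHt s' > 0`, hence in
the cap region; so outside the cap `1/4 ≤ s'`, and `s' = 2ρ₄ - t (2ρ₄ - 1/4)` for some `t ∈ [0, 1]`. -/
theorem range_arcK_diff_capU_subset_range_tArc (hg : 2 ≤ g) (k : ℕ) :
    range (arcK hg k) \ capU ⊆ range (tArc hg k) := by
  rintro p ⟨⟨u, rfl⟩, hpU⟩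
  have h4 : 0 < rho4 hg := rho4_pos hg
  have hcap : capR ≤ rho4 hg := capR_le_rho4 hg
  set s' : ℝ := 2 * rho4 hg * u with hs'
  have hs'0 : 0 ≤ s' := mul_nonneg (by linarith) u.2.1
  have hs'1 : s' ≤ 2 * rho4 hg := mul_le_of_le_one_right (by linarith) u.2.2
  have hp : arcK hg k u = Rk g k (vArcFun hg s') := by rw [arcK_apply, vArc_apply]
  -- outside the cap the parameter is at least `1/4`
  have hge : capR ≤ s' := by
    by_contra hlt
    push Not at hlt
    have hsρ : s' ≤ rho4 hg := by linarith
    apply hpU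
    rw [hp, vArcFun_of_le hg hsρ, Rk_lift_pol_add]
    refine ⟨?_, ?_⟩
    · rw [map_add, map_smul, proj_lift, proj_ez, smul_zero, add_zero, norm_pol, abs_of_nonneg hs'0]
      exact hlt
    · have : (lift (pol s' (π / g + νk g k)) + vHt g s' • ez) 2 = vHt g s' := by simp
      rw [this]
      exact vHt_pos hg hs'0 (lt_of_lt_of_le hlt hcap)
  -- the parameter of the truncated arc
  have hden : 0 < 2 * rho4 hg - capR := by linarith
  set t : ℝ := (2 * rho4 hg - s') / (2 * rho4 hg - capR) with ht
  have ht0 : 0 ≤ t := div_nonneg (by linarith) hden.le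
  have ht1 : t ≤ 1 := by rw [ht, div_le_one hden]; linarith
  refine ⟨⟨t, ht0, ht1⟩, ?_⟩
  rw [tArc_apply, tArcFun, hp]
  congr 2
  show 2 * rho4 hg - t * (2 * rho4 hg - capR) = s'
  rw [ht, div_mul_cancel₀ _ hden.ne']
  ring

/-- Set algebra: `(A \\ U) ∩ (B \\ U) = (A ∩ B) \\ U`. -/
theorem diff_inter_diff_eq {α : Type*} (A B U : Set α) : (A \ U) ∩ (B \ U) = (A ∩ B) \ U := by
  ext x
  simp only [mem_inter_iff, mem_sdiff]
  tauto

/-- **stub — the seams of the capped melon** (`g = n + 2`): consecutive capped slices meet in the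
truncated arcs, the last one meets the union of the others in the two truncated arcs through the
lower pole (the melon incidences of `FlowerMelon` minus the cap). -/
theorem stub_capSeams : ∀ {n : ℕ} (hg : 2 ≤ n + 2), (∀ k, 1 ≤ k → k ≤ n → (⋃ j ≤ k - 1, capS (n + 2) j) ∩ capS (n + 2) k ⊆ range (tArc hg k)) ∧ (⋃ j ≤ n, capS (n + 2) j) ∩ capS (n + 2) (n + 1) ⊆ range (tArc hg (n + 1)) ∪ range (tArc hg 0) := by
  intro n hg
  -- the unions of capped slices are the unions of slices minus the cap
  have hU : ∀ m : ℕ, (⋃ j ≤ m, capS (n + 2) j) = (⋃ j ≤ m, secS (n + 2) j) \ capU := fun m => by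
    simp only [iUnion_sdiff, capS]
  refine ⟨fun k hk hkn => ?_, ?_⟩
  · -- consecutive slices meet in the `k`-th arc (`FlowerMelon`, `fanW_inter_secW_subset`)
    have hmel : (⋃ j ≤ k - 1, secS (n + 2) j) ∩ secS (n + 2) k ⊆ range (arcK hg k) := by
      rw [iUnion_secS_eq hg (by omega), secS_eq hg, range_arcK, ← inter_inter_distrib_left,
        ← preimage_inter]
      exact inter_subset_inter_right _ (preimage_mono (fanW_inter_secW_subset hg hk (by omega)))
    rw [hU, capS, diff_inter_diff_eq]
    exact (sdiff_subset_sdiff_left hmel).trans (range_arcK_diff_capU_subset_range_tArc hg k)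
  · -- the last slice meets the union of the others in the two closing arcs
    have hmel : (⋃ j ≤ n, secS (n + 2) j) ∩ secS (n + 2) (n + 1) ⊆
        range (arcK hg (n + 1)) ∪ range (arcK hg 0) := by
      rw [iUnion_secS_eq hg le_rfl, secS_eq hg, range_arcK, range_arcK, ← inter_inter_distrib_left,
        ← preimage_inter, ← inter_union_distrib_left, ← preimage_union]
      exact inter_subset_inter_right _ (preimage_mono (fanW_inter_secW_last_subset hg))
    rw [hU, capS, diff_inter_diff_eq]
    refine (sdiff_subset_sdiff_left hmel).trans ?_
    rw [union_sdiff_distrib]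
    exact union_subset_union (range_arcK_diff_capU_subset_range_tArc hg (n + 1))
      (range_arcK_diff_capU_subset_range_tArc hg 0)

end FlowerCap

end Summit.SmoothPoincare4.SmoothPoincare4.Cruxes.AgkCor6Sufficiency.LpBySphereSystemSurgery

end
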